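import Mathlib
import Literature.Probability.LatticeModels.GKSInequalities
import Summits.CriticalPhenomena.Ising3DConformalLimit.Theorems.PrecisionLaplacianInverseMFerromagnetSeriesParallelDefs
import Summits.CriticalPhenomena.Ising3DConformalLimit.Theorems.PrecisionLaplacianInverseMFerromagnetSeriesParallel
import HarnessLib

/-!
# Hub pairs: the series–parallel base case of the deletion–contraction induction
# (crux `PrecisionLaplacian.InverseMFerromagnet`, stmt-CriticalPhenomena-4798, line `Sketch`, stub E2)

THEOREM (`stub_im_hubpair`).  For a finite zero-field pair ferromagnet (`gksExpect univ K C`, sites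
`Fin n`, bonds `Fin m` with pair supports `C i`, couplings `K i ≥ 0`) and two sites `p ≠ q` such that
every bond with a NONZERO coupling contains `p` or `q`, the `(p, q)` entry of the inverse spin
second-moment matrix is `≤ 0`.

PROOF.  (1) COVER: on the sites `Fin n` there is a SERIES–PARALLEL structure `D` (in the sense of the
inductive class `IsSeriesParallel`) whose bonds realise every pair containing `p` or `q`
(`chub_cover`): normalise `p = 0`, `q = 1` by a site permutation and build the simple "double fan with
axle" `{0,1}, {0,z}, {1,z} (z ≥ 2)` by induction on the number of sites — one parallel copy of the
axle `{0,1}` followed by its subdivision through the new site (`chub_cover_norm`).  (2) REGROUP: the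
Hamiltonian `∑ i, K i σ_{C i}` only sees bonds with `K i ≠ 0`, all of which are hub pairs, so it equals
the Hamiltonian of `D` with the fibrewise-summed couplings `κ e = ∑_{g i = e} K i ≥ 0`, where `g i` is a
bond of `D` realising `C i` (`chub_gksExpect_regroup`); hence the two second-moment matrices coincide.
(3) Conclude with T-SP, `helper_im_seriesParallel` (p122801).
-/

namespace Summit.CriticalPhenomena.Ising3DConformalLimit.Cruxes.InverseMFerromagnet.PartialCovarianceLadder

open Literature.Probability.LatticeModels Finset Matrix

noncomputable section

/-- A two-element finset is the pair of any two distinct members. [folklore] -/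
theorem chub_eq_pair_of_mem {α : Type*} [DecidableEq α] {s : Finset α} {a b : α}
    (ha : a ∈ s) (hb : b ∈ s) (hab : a ≠ b) (hs : s.card = 2) : s = {a, b} := by
  symm
  apply Finset.eq_of_subset_of_card_le
  · intro x hx
    simp only [Finset.mem_insert, Finset.mem_singleton] at hx
    rcases hx with rfl | rfl
    · exact ha
    · exact hb
  · rw [hs, Finset.card_pair hab]

/-- The single bond `{0, 1}` on two sites is series–parallel (the site `1` is pendant to `0`). [folklore] -/
theorem chub_sp_two : IsSeriesParallel 2 1 (fun _ => ({0, 1} : Finset (Fin 2))) :=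
  IsSeriesParallel.pendant (IsSeriesParallel.base 1 (fun i => i.elim0)) 0 _ (fun i => i.elim0) (by decide)

/-- **Normalised cover.**  On `n + 2` sites there is a series–parallel structure whose bonds realise every
pair containing the site `0` or the site `1` (the double fan `{0,1}, {0,z}, {1,z}`, built by one parallel
copy of `{0,1}` and its subdivision through each new site). [folklore] -/
theorem chub_cover_norm : ∀ n : ℕ, ∃ (m : ℕ) (D : Fin m → Finset (Fin (n + 2))),
    IsSeriesParallel (n + 2) m D ∧
      ∀ s : Finset (Fin (n + 2)), s.card = 2 → ((0 : Fin (n + 2)) ∈ s ∨ (1 : Fin (n + 2)) ∈ s) →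
        ∃ e, D e = s := by
  intro n
  induction n with
  | zero =>
      refine ⟨1, fun _ => {0, 1}, chub_sp_two, fun s hs _ => ⟨0, ?_⟩⟩
      rw [Finset.eq_univ_of_card s (by simpa using hs)]
      decide
  | succ n ih =>
      obtain ⟨m, D, hD, hcov⟩ := ih
      show ∃ (m' : ℕ) (D' : Fin m' → Finset (Fin (n + 2 + 1))), IsSeriesParallel (n + 2 + 1) m' D' ∧
        ∀ s : Finset (Fin (n + 2 + 1)), s.card = 2 →
          ((0 : Fin (n + 2 + 1)) ∈ s ∨ (1 : Fin (n + 2 + 1)) ∈ s) → ∃ e, D' e = s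
      obtain ⟨e₀, he₀⟩ := hcov {0, 1} (Finset.card_pair Fin.zero_ne_one) (Or.inl (by simp))
      -- one parallel copy of the axle `{0, 1}`, appended as the last bond
      set P : Fin (m + 1) → Finset (Fin (n + 2)) := Fin.snoc D (D e₀) with hP
      have hPsp : IsSeriesParallel (n + 2) (m + 1) P :=
        IsSeriesParallel.parallel hD e₀ P (fun i => by simp [hP]) (by simp [hP, he₀])
      -- … subdivided through the new site `Fin.last (n + 2)`
      set D' : Fin (m + 1 + 1) → Finset (Fin (n + 2 + 1)) :=
        Fin.snoc (fun i : Fin (m + 1) => if i = Fin.last m then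
            ({(0 : Fin (n + 2)).castSucc, Fin.last (n + 2)} : Finset (Fin (n + 2 + 1)))
          else (P i).map Fin.castSuccEmb)
          ({Fin.last (n + 2), (1 : Fin (n + 2)).castSucc} : Finset (Fin (n + 2 + 1))) with hD'
      have hD'sp : IsSeriesParallel (n + 2 + 1) (m + 1 + 1) D' := by
        refine IsSeriesParallel.subdivide hPsp (Fin.last m) 0 1 Fin.zero_ne_one (by simp [hP, he₀]) D'
          (fun i hi => ?_) ?_ ?_
        · simp [hD', hi]
        · simp [hD']
        · simp [hD']
      refine ⟨m + 1 + 1, D', hD'sp, fun s hs h01 => ?_⟩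
      by_cases hLs : Fin.last (n + 2) ∈ s
      · rcases h01 with h0 | h1
        · refine ⟨(Fin.last m).castSucc, ?_⟩
          rw [chub_eq_pair_of_mem h0 hLs (ne_of_lt Fin.last_pos) hs]
          simp [hD']
        · refine ⟨Fin.last (m + 1), ?_⟩
          have h1L : Fin.last (n + 2) ≠ (1 : Fin (n + 2 + 1)) :=
            fun h => by have := congrArg Fin.val h; simp at this
          rw [chub_eq_pair_of_mem hLs h1 h1L hs]
          simp [hD']
      · set t : Finset (Fin (n + 2)) := Finset.univ.filter (fun x => x.castSucc ∈ s) with ht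
        have hst : s = t.map Fin.castSuccEmb := by
          ext x
          simp only [ht, Finset.mem_map, Finset.mem_filter, Finset.mem_univ, true_and,
            Fin.castSuccEmb_apply]
          constructor
          · intro hx
            have hxL : x ≠ Fin.last (n + 2) := fun h => hLs (h ▸ hx)
            exact ⟨x.castPred hxL, by simpa using hx, Fin.castSucc_castPred x hxL⟩
          · rintro ⟨y, hy, rfl⟩
            exact hy
        have ht2 : t.card = 2 := by rw [← Finset.card_map Fin.castSuccEmb, ← hst]; exact hs
        have ht01 : (0 : Fin (n + 2)) ∈ t ∨ (1 : Fin (n + 2)) ∈ t := by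
          simp only [ht, Finset.mem_filter, Finset.mem_univ, true_and, Fin.castSucc_zero,
            Fin.castSucc_one]
          exact h01
        obtain ⟨e, he⟩ := hcov t ht2 ht01
        refine ⟨e.castSucc.castSucc, ?_⟩
        rw [hst, ← he]
        simp [hD', hP, Fin.castSucc_ne_last]

/-- **Cover.**  For two distinct sites `p ≠ q` of `Fin n` there is a series–parallel structure on `Fin n`
whose bonds realise every pair containing `p` or `q` (relabel the normalised cover). [folklore] -/
theorem chub_cover {n : ℕ} (p q : Fin n) (hpq : p ≠ q) :
    ∃ (m : ℕ) (D : Fin m → Finset (Fin n)), IsSeriesParallel n m D ∧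
      ∀ s : Finset (Fin n), s.card = 2 → (p ∈ s ∨ q ∈ s) → ∃ e, D e = s := by
  obtain ⟨k, rfl⟩ : ∃ k, n = k + 2 :=
    ⟨n - 2, by have := p.isLt; have := q.isLt; have := Fin.val_ne_of_ne hpq; omega⟩
  obtain ⟨m, D₀, hD₀, hcov⟩ := chub_cover_norm k
  -- a site permutation `τ` with `τ 0 = p`, `τ 1 = q`
  set σ₁ : Equiv.Perm (Fin (k + 2)) := Equiv.swap 0 p with hσ₁
  have hq' : σ₁ q ≠ 0 := by
    intro h
    apply hpq
    have h' : σ₁ (σ₁ q) = σ₁ 0 := congrArg σ₁ h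
    rw [hσ₁, Equiv.swap_apply_self, Equiv.swap_apply_left] at h'
    exact h'.symm
  set τ : Equiv.Perm (Fin (k + 2)) := (Equiv.swap 1 (σ₁ q)).trans σ₁ with hτ
  have hτ0 : τ 0 = p := by
    rw [hτ, Equiv.trans_apply, Equiv.swap_apply_of_ne_of_ne Fin.zero_ne_one hq'.symm, hσ₁,
      Equiv.swap_apply_left]
  have hτ1 : τ 1 = q := by
    rw [hτ, Equiv.trans_apply, Equiv.swap_apply_left, hσ₁, Equiv.swap_apply_self]
  refine ⟨m, fun e => (D₀ e).map τ.toEmbedding,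
    IsSeriesParallel.relabel hD₀ τ (Equiv.refl _) _ (fun e => rfl), fun s hs hpqs => ?_⟩
  obtain ⟨e, he⟩ := hcov (s.map τ.symm.toEmbedding) (by rw [Finset.card_map]; exact hs)
    (by simp only [Finset.mem_map_equiv, Equiv.symm_symm, hτ0, hτ1]; exact hpqs)
  refine ⟨e, ?_⟩
  ext x
  simp only [he, Finset.mem_map_equiv, Equiv.symm_symm, Equiv.apply_symm_apply]

/-- **Regrouping the couplings.**  If `g` sends every bond `i` with `K i ≠ 0` to a bond `g i` of another
structure `D` with the same support, then the Gibbs expectations of `(K, C)` and of `D` with the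
fibrewise-summed couplings `κ e = ∑_{g i = e} K i` agree (the Hamiltonians agree pointwise). [folklore] -/
theorem chub_gksExpect_regroup {n m m' : ℕ} (K : Fin m → ℝ) (C : Fin m → Finset (Fin n))
    (D : Fin m' → Finset (Fin n)) (g : Fin m → Fin m') (hg : ∀ i, K i ≠ 0 → D (g i) = C i)
    (f : SpinConfig (Fin n) → ℝ) :
    gksExpect Finset.univ K C f =
      gksExpect Finset.univ (fun e => ∑ i ∈ Finset.univ.filter (fun i => g i = e), K i) D f := by
  have hH : ∀ ω, gksHamiltonian Finset.univ
      (fun e => ∑ i ∈ Finset.univ.filter (fun i => g i = e), K i) D ω =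
        gksHamiltonian Finset.univ K C ω := by
    intro ω
    simp only [gksHamiltonian, Finset.sum_mul]
    rw [show (∑ e, ∑ i ∈ Finset.univ.filter (fun i => g i = e), K i * spinProduct (D e) ω) =
        ∑ e, ∑ i ∈ Finset.univ.filter (fun i => g i = e), K i * spinProduct (D (g i)) ω from
      Finset.sum_congr rfl fun e _ => Finset.sum_congr rfl fun i hi => by
        rw [(Finset.mem_filter.1 hi).2],
      Finset.sum_fiberwise Finset.univ g (fun i => K i * spinProduct (D (g i)) ω)]
    refine Finset.sum_congr rfl fun i _ => ?_
    by_cases hKi : K i = 0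
    · simp [hKi]
    · rw [hg i hKi]
  unfold gksExpect gksSum gksWeight
  simp_rw [hH]

/-- **E2 · hub pairs (base of the deletion–contraction induction; finite, series–parallel).**  If every
bond with a nonzero coupling contains `p` or `q`, the `(p,q)` precision entry is `≤ 0`: the Hamiltonian
is that of the series–parallel double fan `{p,q}, {p,z}, {q,z}` with fibrewise-summed nonnegative
couplings (`chub_cover`, `chub_gksExpect_regroup`), so T-SP `helper_im_seriesParallel` (p122801)
applies. [folklore] -/
theorem stub_im_hubpair :
    ∀ (n m : ℕ) (K : Fin m → ℝ) (C : Fin m → Finset (Fin n)), (∀ i, 0 ≤ K i) → (∀ i, (C i).card = 2) →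
      ∀ (p q : Fin n), p ≠ q → (∀ i, K i ≠ 0 → p ∈ C i ∨ q ∈ C i) →
        (Matrix.of fun a b : Fin n => gksExpect Finset.univ K C (fun ω => spinAt a ω * spinAt b ω))⁻¹ p q ≤ 0 := by
  intro n m K C hK hC2 p q hpq hhub
  obtain ⟨m', D, hSP, hcov⟩ := chub_cover p q hpq
  have hsi : ∀ i, ∃ e, D e = if p ∈ C i ∨ q ∈ C i then C i else {p, q} := by
    intro i
    split_ifs with h
    · exact hcov (C i) (hC2 i) h
    · exact hcov {p, q} (Finset.card_pair hpq) (Or.inl (Finset.mem_insert_self p {q}))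
  choose g hg using hsi
  have hgC : ∀ i, K i ≠ 0 → D (g i) = C i := fun i hi => by rw [hg i, if_pos (hhub i hi)]
  have hmat : (Matrix.of fun a b : Fin n => gksExpect Finset.univ K C (fun ω => spinAt a ω * spinAt b ω)) =
      Matrix.of fun a b : Fin n => gksExpect Finset.univ
        (fun e => ∑ i ∈ Finset.univ.filter (fun i => g i = e), K i) D
        (fun ω => spinAt a ω * spinAt b ω) := by
    ext a b
    exact chub_gksExpect_regroup K C D g hgC _
  rw [hmat]
  exact helper_im_seriesParallel n m' _ D hSP (fun e => Finset.sum_nonneg fun i _ => hK i) p q hpq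

end

end Summit.CriticalPhenomena.Ising3DConformalLimit.Cruxes.InverseMFerromagnet.PartialCovarianceLadder
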